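import Mathlib
import HarnessLib
import Summits.Ventures.LatticeQCDFlow.Scaling.TorusRankedMorseStructure
import Summits.Ventures.LatticeQCDFlow.Scaling.TorusRankedHomologyBound

/-!
# LatticeQCDFlow / Scaling — the Morse structure has `(d−1)(L^d − 1)` plaquettes: the homology bound is
# attained, and the least number of plaquettes of `(ℤ/L)^d` outside an exact one-plaquette heat-bath
# autoregression is EXACTLY `(d−1)(d−2)/2·L^d + (d−1)` in every dimension

HONEST FRAMING: exact (Metropolis-corrected) sampling algorithms for lattice gauge theory;
figures of merit are autocorrelation/cost numbers at stated couplings and volumes; no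
continuum-physics claim.

Venture `LatticeQCDFlow` (cell pub-lqcd), topic `Scaling`, FANOUT row 30 (lean-1, GEN-25) — OUR WORK on
THEORY-2.md §4 row C5.  `TorusRankedHomologyBound`: every ranked plaquette structure `B` of `(ℤ/L)^d`
(`L ≥ 2`) has `#B + #sites + d ≤ #links + 1`, i.e. leaves `2k ≥ (d−1)(d−2)·L^d + 2(d−1)` plaquettes
outside.  `TorusRankedMorseStructure`: the plaquettes matched downwards by the product of the perfect
acyclic matchings of the cycle form a ranked structure (`morse_rank_lt`).  THIS FILE counts it and closes
the question in every dimension: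

* §1 counting: for the axis pair `i < j` the Morse sites split into `{x_{<i} = 0, x_i ≠ −1}`
  (`(L−1)·L^{d−1−i}` of them, a product set — `card_filter_prefix_ne`) and
  `{x_{<i} = 0, x_i = −1, x_{(i,j)} = 0, x_j ≠ −1}` (`(L−1)·L^{d−1−j}`, `card_filter_prefix_eq_mid_ne`);
  `Σ_{i<j} (f i + f j) = (d−1)·Σ_n f n` (`sum_pairs_add`) and the geometric sum give
  **`card_morse`**: `#B = (d−1)(L^d − 1) = #links − #sites + 1 − d`;
* §2 **`card_compl_morse`**: `k = (d−1)(d−2)/2·L^d + (d−1)`; **`exists_ranked_card_compl_eq`**: in every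
  dimension a ranked structure with injective top links leaving exactly that many plaquettes outside;
* §3 **`isLeast_card_compl_ranked`** — THE EXACT ANSWER: for every `d` and every `L ≥ 2` the least number
  of plaquettes of `(ℤ/L)^d` outside a ranked one-plaquette heat-bath structure is
  `(d−1)(d−2)/2·L^d + (d−1)` (`1` in `d = 2` — the comb; `L³ + 2` in `d = 3`;
  **`isLeast_card_compl_ranked_four`**: `3L⁴ + 3` in `d = 4`, against the layers' `3L⁴ + 3L³`): a
  fraction `(d−2)/d + O(L^{−d})` of the plaquettes rides on the Metropolis step, no more and no less.

No `def`, no `sorry`, nothing cited as a fact beyond the tree.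
-/

namespace Summit.Ventures.LatticeQCDFlow.Theory2.Autoregressive

open Finset
open Literature.MathematicalPhysics.QuantumFieldTheory

variable {d L : ℕ} [NeZero L]

/-! ## §1 Counting the Morse structure -/

omit [NeZero L] in
/-- A product over `Fin d` of `1` below `i`, `a` at `i` and `b` above `i` is `a · b^(d − 1 − i)`. [ours] -/
theorem prod_ite_lt_eq_ite (i : Fin d) (a b : ℕ) :
    ∏ m : Fin d, (if m < i then 1 else if m = i then a else b) = a * b ^ (d - 1 - i) := by
  classical
  rw [← Finset.prod_filter_mul_prod_filter_not Finset.univ (fun m : Fin d => m < i)]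
  have h1 : ∏ m ∈ Finset.univ.filter (fun m : Fin d => m < i),
      (if m < i then 1 else if m = i then a else b) = 1 :=
    Finset.prod_eq_one fun m hm => by rw [if_pos (Finset.mem_filter.1 hm).2]
  rw [h1, one_mul, ← Finset.prod_filter_mul_prod_filter_not (Finset.univ.filter fun m : Fin d => ¬ m < i)
    (fun m : Fin d => m = i)]
  have h2 : (Finset.univ.filter fun m : Fin d => ¬ m < i).filter (fun m : Fin d => m = i) = {i} := by
    ext m
    simp only [Finset.mem_filter, Finset.mem_univ, true_and, Finset.mem_singleton]
    constructor
    · exact fun h => h.2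
    · intro h; subst h; exact ⟨lt_irrefl _, rfl⟩
  have h3 : (Finset.univ.filter fun m : Fin d => ¬ m < i).filter (fun m : Fin d => ¬ m = i) = Finset.Ioi i := by
    ext m
    simp only [Finset.mem_filter, Finset.mem_univ, true_and, Finset.mem_Ioi]
    constructor
    · rintro ⟨h1, h2⟩; exact lt_of_le_of_ne (not_lt.1 h1) (Ne.symm h2)
    · intro h; exact ⟨not_lt.2 h.le, ne_of_gt h⟩
  rw [h2, h3, Finset.prod_singleton, if_neg (lt_irrefl _), if_pos rfl]
  have h4 : ∏ m ∈ Finset.Ioi i, (if m < i then 1 else if m = i then a else b) = ∏ _m ∈ Finset.Ioi i, b :=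
    Finset.prod_congr rfl fun m hm => by
      have hm' : i < m := Finset.mem_Ioi.1 hm
      rw [if_neg (not_lt.2 hm'.le), if_neg (ne_of_gt hm')]
  rw [h4, Finset.prod_const, Fin.card_Ioi]

/-- The sites with `x_m = 0` below `i` and `x_i ≠ −1` number `(L − 1)·L^(d − 1 − i)`. [ours] -/
theorem card_filter_prefix_ne (i : Fin d) :
    (Finset.univ.filter fun x : Site d L => (∀ m : Fin d, m < i → x m = 0) ∧ x i ≠ -1).card =
      (L - 1) * L ^ (d - 1 - i) := by
  classical
  have hset : (Finset.univ.filter fun x : Site d L => (∀ m : Fin d, m < i → x m = 0) ∧ x i ≠ -1) =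
      Fintype.piFinset (fun m : Fin d =>
        if m < i then ({0} : Finset (ZMod L)) else if m = i then Finset.univ.erase (-1) else Finset.univ) := by
    ext x
    simp only [Finset.mem_filter, Finset.mem_univ, true_and, Fintype.mem_piFinset]
    constructor
    · rintro ⟨hpre, hi⟩ m
      by_cases hm : m < i
      · rw [if_pos hm, Finset.mem_singleton]; exact hpre m hm
      · rw [if_neg hm]
        by_cases hmi : m = i
        · rw [if_pos hmi, hmi]; exact Finset.mem_erase.2 ⟨hi, Finset.mem_univ _⟩
        · rw [if_neg hmi]; exact Finset.mem_univ _
    · intro h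
      refine ⟨fun m hm => ?_, ?_⟩
      · have := h m; rw [if_pos hm, Finset.mem_singleton] at this; exact this
      · have := h i; rw [if_neg (lt_irrefl _), if_pos rfl] at this; exact (Finset.mem_erase.1 this).1
  rw [hset, Fintype.card_piFinset]
  have hcard : ∀ m : Fin d, (if m < i then ({0} : Finset (ZMod L)) else if m = i then Finset.univ.erase (-1)
      else Finset.univ).card = if m < i then 1 else if m = i then L - 1 else L := by
    intro m
    split_ifs
    · rfl
    · rw [Finset.card_erase_of_mem (Finset.mem_univ _), Finset.card_univ, ZMod.card]
    · rw [Finset.card_univ, ZMod.card]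
  simp_rw [hcard]
  exact prod_ite_lt_eq_ite i (L - 1) L

/-- The sites with `x_m = 0` below `i`, `x_i = −1`, `x_m = 0` strictly between `i` and `j`, `x_j ≠ −1`
(`i < j`) number `(L − 1)·L^(d − 1 − j)`. [ours] -/
theorem card_filter_prefix_eq_mid_ne {i j : Fin d} (hij : i < j) :
    (Finset.univ.filter fun x : Site d L => (∀ m : Fin d, m < i → x m = 0) ∧ x i = -1 ∧
      (∀ m : Fin d, i < m → m < j → x m = 0) ∧ x j ≠ -1).card = (L - 1) * L ^ (d - 1 - j) := by
  classical
  have hset : (Finset.univ.filter fun x : Site d L => (∀ m : Fin d, m < i → x m = 0) ∧ x i = -1 ∧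
      (∀ m : Fin d, i < m → m < j → x m = 0) ∧ x j ≠ -1) =
      Fintype.piFinset (fun m : Fin d =>
        if m < j then (if m = i then ({-1} : Finset (ZMod L)) else {0})
        else if m = j then Finset.univ.erase (-1) else Finset.univ) := by
    ext x
    simp only [Finset.mem_filter, Finset.mem_univ, true_and, Fintype.mem_piFinset]
    constructor
    · rintro ⟨hpre, hi, hmid, hj⟩ m
      by_cases hm : m < j
      · rw [if_pos hm]
        by_cases hmi : m = i
        · rw [if_pos hmi, Finset.mem_singleton, hmi]; exact hi
        · rw [if_neg hmi, Finset.mem_singleton]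
          rcases lt_or_gt_of_ne hmi with h | h
          · exact hpre m h
          · exact hmid m h hm
      · rw [if_neg hm]
        by_cases hmj : m = j
        · rw [if_pos hmj, hmj]; exact Finset.mem_erase.2 ⟨hj, Finset.mem_univ _⟩
        · rw [if_neg hmj]; exact Finset.mem_univ _
    · intro h
      refine ⟨fun m hm => ?_, ?_, fun m hm1 hm2 => ?_, ?_⟩
      · have := h m
        rw [if_pos (hm.trans hij), if_neg (ne_of_lt hm), Finset.mem_singleton] at this; exact this
      · have := h i; rw [if_pos hij, if_pos rfl, Finset.mem_singleton] at this; exact this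
      · have := h m; rw [if_pos hm2, if_neg (ne_of_gt hm1), Finset.mem_singleton] at this; exact this
      · have := h j; rw [if_neg (lt_irrefl _), if_pos rfl] at this; exact (Finset.mem_erase.1 this).1
  rw [hset, Fintype.card_piFinset]
  have hcard : ∀ m : Fin d, (if m < j then (if m = i then ({-1} : Finset (ZMod L)) else {0})
      else if m = j then Finset.univ.erase (-1) else Finset.univ).card =
      if m < j then 1 else if m = j then L - 1 else L := by
    intro m
    split_ifs
    · rfl
    · rfl
    · rw [Finset.card_erase_of_mem (Finset.mem_univ _), Finset.card_univ, ZMod.card]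
    · rw [Finset.card_univ, ZMod.card]
  simp_rw [hcard]
  exact prod_ite_lt_eq_ite j (L - 1) L

omit [NeZero L] in
/-- `Σ_{n < d} (L − 1)·L^(d − 1 − n) = L^d − 1` (the geometric sum). [folklore] -/
theorem sum_pred_mul_pow_rev (hL : 1 ≤ L) :
    ∑ n : Fin d, (L - 1) * L ^ (d - 1 - (n : ℕ)) = L ^ d - 1 := by
  rw [← Finset.mul_sum]
  have h1 : ∑ n : Fin d, L ^ (d - 1 - (n : ℕ)) = ∑ e ∈ Finset.range d, L ^ e := by
    rw [Fin.sum_univ_eq_sum_range (fun n => L ^ (d - 1 - n))]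
    exact Finset.sum_range_reflect (fun e => L ^ e) d
  rw [h1, mul_comm, geom_sum_mul_of_one_le hL]

omit [NeZero L] in
/-- `Σ_{i < j} (f i + f j) = (d − 1)·Σ_n f n` over the axis pairs of `Fin d`. [folklore] -/
theorem sum_pairs_add (f : Fin d → ℕ) :
    ∑ q : {q : Fin d × Fin d // q.1 < q.2}, (f q.1.1 + f q.1.2) = (d - 1) * ∑ n : Fin d, f n := by
  classical
  have hsub : ∑ q : {q : Fin d × Fin d // q.1 < q.2}, (f q.1.1 + f q.1.2) =
      ∑ q ∈ Finset.univ.filter (fun q : Fin d × Fin d => q.1 < q.2), (f q.1 + f q.2) :=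
    (Finset.sum_subtype (Finset.univ.filter (fun q : Fin d × Fin d => q.1 < q.2))
      (fun q => by simp) (fun q : Fin d × Fin d => f q.1 + f q.2)).symm
  rw [hsub, Finset.sum_add_distrib]
  have hswap : ∑ q ∈ Finset.univ.filter (fun q : Fin d × Fin d => q.1 < q.2), f q.2 =
      ∑ q ∈ Finset.univ.filter (fun q : Fin d × Fin d => q.2 < q.1), f q.1 := by
    refine Finset.sum_equiv (Equiv.prodComm (Fin d) (Fin d)) (fun q => ?_) (fun q _ => rfl)
    simp
  rw [hswap, ← Finset.sum_union]
  · have hunion : Finset.univ.filter (fun q : Fin d × Fin d => q.1 < q.2) ∪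
        Finset.univ.filter (fun q : Fin d × Fin d => q.2 < q.1) =
        Finset.univ.filter (fun q : Fin d × Fin d => q.1 ≠ q.2) := by
      ext q
      simp only [Finset.mem_union, Finset.mem_filter, Finset.mem_univ, true_and]
      exact lt_or_lt_iff_ne
    rw [hunion, Finset.sum_filter, Fintype.sum_prod_type]
    simp only [Finset.sum_ite, Finset.sum_const_zero, add_zero, Finset.sum_const, smul_eq_mul]
    rw [Finset.mul_sum]
    refine Finset.sum_congr rfl fun a _ => ?_
    rw [Finset.filter_ne Finset.univ a, Finset.card_erase_of_mem (Finset.mem_univ a), Finset.card_univ,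
      Fintype.card_fin, mul_comm]
  · rw [Finset.disjoint_filter]
    intro q _ h1 h2
    exact lt_asymm h1 h2

/-- **The Morse structure has exactly `(d−1)(L^d − 1)` plaquettes** (`L ≥ 2`): for each axis pair `i < j`
the two disjoint site classes number `(L−1)L^{d−1−i}` and `(L−1)L^{d−1−j}`, and
`Σ_{i<j} (f i + f j) = (d−1)Σ_n f n = (d−1)(L^d − 1)`. [ours] -/
theorem card_morse (hL : 2 ≤ L) (B : Finset (Plaquette d L))
    (hB : B = Finset.univ.filter (fun p : Plaquette d L =>
      (∀ m : Fin d, m < p.2.1.1 → p.1 m = 0) ∧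
        (p.1 p.2.1.1 ≠ -1 ∨ ((∀ m : Fin d, p.2.1.1 < m → m < p.2.1.2 → p.1 m = 0) ∧ p.1 p.2.1.2 ≠ -1)))) :
    B.card = (d - 1) * (L ^ d - 1) := by
  classical
  subst hB
  -- sum over the axis pairs
  rw [Finset.card_filter, Fintype.sum_prod_type_right]
  have hq : ∀ q : {q : Fin d × Fin d // q.1 < q.2},
      ∑ x : Site d L, (if (∀ m : Fin d, m < q.1.1 → x m = 0) ∧
          (x q.1.1 ≠ -1 ∨ ((∀ m : Fin d, q.1.1 < m → m < q.1.2 → x m = 0) ∧ x q.1.2 ≠ -1)) then 1 else 0) =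
        (L - 1) * L ^ (d - 1 - (q.1.1 : ℕ)) + (L - 1) * L ^ (d - 1 - (q.1.2 : ℕ)) := by
    intro q
    obtain ⟨⟨i, j⟩, hij⟩ := q
    simp only
    rw [← Finset.card_filter, ← card_filter_prefix_ne i, ← card_filter_prefix_eq_mid_ne hij,
      ← Finset.card_union_of_disjoint]
    · congr 1
      ext x
      simp only [Finset.mem_filter, Finset.mem_univ, true_and, Finset.mem_union]
      by_cases hxi : x i = -1
      · simp [hxi]
      · simp [hxi]
    · rw [Finset.disjoint_filter]
      rintro x - ⟨-, h1⟩ ⟨-, h2, -⟩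
      exact h1 h2
  simp_rw [hq]
  rw [sum_pairs_add (fun n : Fin d => (L - 1) * L ^ (d - 1 - (n : ℕ))), sum_pred_mul_pow_rev (by omega)]


/-! ## §2 The number of plaquettes outside -/

omit [NeZero L] in
/-- `2·((d−1)(d−2)/2) = (d−1)(d−2)` (a product of consecutive naturals is even). [folklore] -/
theorem two_mul_choose_coeff (d : ℕ) : 2 * ((d - 1) * (d - 2) / 2) = (d - 1) * (d - 2) := by
  apply Nat.two_mul_div_two_of_even
  have h := Nat.even_mul_pred_self (d - 1)
  rwa [Nat.sub_sub] at h

/-- **The Morse structure leaves exactly `k = (d−1)(d−2)/2·L^d + (d−1)` plaquettes outside** (`L ≥ 2`):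
`2k = d(d−1)L^d − 2(d−1)(L^d − 1) = (d−1)(d−2)L^d + 2(d−1)`. [ours] -/
theorem card_compl_morse (hL : 2 ≤ L) (B : Finset (Plaquette d L))
    (hB : B = Finset.univ.filter (fun p : Plaquette d L =>
      (∀ m : Fin d, m < p.2.1.1 → p.1 m = 0) ∧
        (p.1 p.2.1.1 ≠ -1 ∨ ((∀ m : Fin d, p.2.1.1 < m → m < p.2.1.2 → p.1 m = 0) ∧ p.1 p.2.1.2 ≠ -1)))) :
    (Finset.univ \ B).card = (d - 1) * (d - 2) / 2 * L ^ d + (d - 1) := by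
  have hcard := card_morse hL B hB
  have hc : (Finset.univ \ B).card + B.card = Fintype.card (Plaquette d L) := by
    rw [Finset.card_univ_sdiff]
    have := Finset.card_le_univ B
    omega
  have hP := two_mul_card_plaquette d L
  rw [Summit.Ventures.LatticeQCDFlow.Runbook.card_site] at hP
  have hE := two_mul_choose_coeff d
  have hX : 1 ≤ L ^ d := Nat.one_le_pow _ _ (by omega)
  -- `2k = (d−1)(d−2)·L^d + 2(d−1)`
  have h2k : 2 * (Finset.univ \ B).card = (d - 1) * (d - 2) * L ^ d + 2 * (d - 1) := by
    rcases Nat.lt_or_ge d 2 with hd | hd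
    · have hd' : d = 0 ∨ d = 1 := by omega
      rcases hd' with rfl | rfl
      · simp only [pow_zero] at hP hcard ⊢
        omega
      · simp only [pow_one] at hP hcard ⊢
        omega
    · obtain ⟨n, rfl⟩ : ∃ n, d = n + 2 := ⟨d - 2, by omega⟩
      rw [show n + 2 - 1 = n + 1 from rfl] at hcard hP ⊢
      rw [show n + 2 - 2 = n from rfl]
      obtain ⟨Y, hY⟩ : ∃ Y, L ^ (n + 2) = Y + 1 := ⟨L ^ (n + 2) - 1, by omega⟩
      rw [hY] at hcard hP ⊢
      rw [Nat.add_sub_cancel] at hcard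
      have h2 : 2 * (Finset.univ \ B).card + 2 * ((n + 1) * Y) = (Y + 1) * ((n + 2) * (n + 1)) := by
        rw [← hcard, ← hP]; omega
      nlinarith [h2]
  have h3 : (d - 1) * (d - 2) * L ^ d = 2 * ((d - 1) * (d - 2) / 2 * L ^ d) := by rw [← mul_assoc, hE]
  omega

/-- **In every dimension a ranked structure attaining the homology bound** (`L ≥ 2`): injective top links,
links of their plaquettes, ranked, exactly `(d−1)(d−2)/2·L^d + (d−1)` plaquettes outside and
`(d−1)(L^d − 1)` inside. [ours] -/
theorem exists_ranked_card_compl_eq (hL : 2 ≤ L) :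
    ∃ (B : Finset (Plaquette d L)) (t : Plaquette d L → Edge d L) (rank : Plaquette d L → ℕ),
      Set.InjOn t B ∧
      (∀ p ∈ B, t p ∈ ({(p.1, p.2.1.1), (p.1.shift p.2.1.1, p.2.1.2),
        (p.1.shift p.2.1.2, p.2.1.1), (p.1, p.2.1.2)} : Finset (Edge d L))) ∧
      (∀ p ∈ B, ∀ p' ∈ B, p ≠ p' → t p ∈ ({(p'.1, p'.2.1.1), (p'.1.shift p'.2.1.1, p'.2.1.2),
        (p'.1.shift p'.2.1.2, p'.2.1.1), (p'.1, p'.2.1.2)} : Finset (Edge d L)) → rank p < rank p') ∧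
      (Finset.univ \ B).card = (d - 1) * (d - 2) / 2 * L ^ d + (d - 1) ∧
      B.card = (d - 1) * (L ^ d - 1) :=
  ⟨_, _, _, morse_injOn hL _ _ rfl rfl, fun p _ => morse_mem_links _ rfl p,
    morse_rank_lt hL _ _ _ rfl rfl rfl, card_compl_morse hL _ rfl, card_morse hL _ rfl⟩

/-! ## §3 The exact answer in every dimension -/

/-- **THE LEAST NUMBER OF PLAQUETTES OUTSIDE A RANKED STRUCTURE OF `(ℤ/L)^d` IS EXACTLY
`(d−1)(d−2)/2·L^d + (d−1)`** (`L ≥ 2`, every `d`): the homology bound of `TorusRankedHomologyBound` and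
the Morse structure. [ours] -/
theorem isLeast_card_compl_ranked (hL : 2 ≤ L) :
    IsLeast {k : ℕ | ∃ (B : Finset (Plaquette d L)) (t : Plaquette d L → Edge d L) (rank : Plaquette d L → ℕ),
      (∀ p ∈ B, t p ∈ ({(p.1, p.2.1.1), (p.1.shift p.2.1.1, p.2.1.2),
        (p.1.shift p.2.1.2, p.2.1.1), (p.1, p.2.1.2)} : Finset (Edge d L))) ∧
      (∀ p ∈ B, ∀ p' ∈ B, p ≠ p' → t p ∈ ({(p'.1, p'.2.1.1), (p'.1.shift p'.2.1.1, p'.2.1.2),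
        (p'.1.shift p'.2.1.2, p'.2.1.1), (p'.1, p'.2.1.2)} : Finset (Edge d L)) → rank p < rank p') ∧
      (Finset.univ \ B).card = k} ((d - 1) * (d - 2) / 2 * L ^ d + (d - 1)) := by
  obtain ⟨B, t, rank, -, ht, hrank, hk, -⟩ := exists_ranked_card_compl_eq (d := d) hL
  refine ⟨⟨B, t, rank, ht, hrank, hk⟩, ?_⟩
  rintro k ⟨B', t', rank', ht', hrank', rfl⟩
  have h := homologyBound_closed_form hL B' t' ht' rank' hrank'
  have hE := two_mul_choose_coeff d
  have h3 : (d - 1) * (d - 2) * L ^ d = 2 * ((d - 1) * (d - 2) / 2 * L ^ d) := by rw [← mul_assoc, hE]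
  omega

/-- **`d = 4`: the least number of plaquettes of `(ℤ/L)⁴` outside a ranked structure is exactly `3L⁴ + 3`**
(`L ≥ 2`; of `6L⁴` plaquettes; the layers of `TorusRankedLayers` leave `3L⁴ + 3L³`). [ours] -/
theorem isLeast_card_compl_ranked_four (hL : 2 ≤ L) :
    IsLeast {k : ℕ | ∃ (B : Finset (Plaquette 4 L)) (t : Plaquette 4 L → Edge 4 L) (rank : Plaquette 4 L → ℕ),
      (∀ p ∈ B, t p ∈ ({(p.1, p.2.1.1), (p.1.shift p.2.1.1, p.2.1.2),
        (p.1.shift p.2.1.2, p.2.1.1), (p.1, p.2.1.2)} : Finset (Edge 4 L))) ∧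
      (∀ p ∈ B, ∀ p' ∈ B, p ≠ p' → t p ∈ ({(p'.1, p'.2.1.1), (p'.1.shift p'.2.1.1, p'.2.1.2),
        (p'.1.shift p'.2.1.2, p'.2.1.1), (p'.1, p'.2.1.2)} : Finset (Edge 4 L)) → rank p < rank p') ∧
      (Finset.univ \ B).card = k} (3 * L ^ 4 + 3) := by
  have h := isLeast_card_compl_ranked (d := 4) hL
  have e : (4 - 1) * (4 - 2) / 2 * L ^ 4 + (4 - 1) = 3 * L ^ 4 + 3 := by norm_num
  rw [e] at h
  exact h

/-- **`d = 2`: the least number is exactly `1`** (`L ≥ 2`) — the comb of `AutoregressiveGaugeHeatBathComb`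
and the Morse structure both attain it. [ours] -/
theorem isLeast_card_compl_ranked_two (hL : 2 ≤ L) :
    IsLeast {k : ℕ | ∃ (B : Finset (Plaquette 2 L)) (t : Plaquette 2 L → Edge 2 L) (rank : Plaquette 2 L → ℕ),
      (∀ p ∈ B, t p ∈ ({(p.1, p.2.1.1), (p.1.shift p.2.1.1, p.2.1.2),
        (p.1.shift p.2.1.2, p.2.1.1), (p.1, p.2.1.2)} : Finset (Edge 2 L))) ∧
      (∀ p ∈ B, ∀ p' ∈ B, p ≠ p' → t p ∈ ({(p'.1, p'.2.1.1), (p'.1.shift p'.2.1.1, p'.2.1.2),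
        (p'.1.shift p'.2.1.2, p'.2.1.1), (p'.1, p'.2.1.2)} : Finset (Edge 2 L)) → rank p < rank p') ∧
      (Finset.univ \ B).card = k} 1 := by
  have h := isLeast_card_compl_ranked (d := 2) hL
  have e : (2 - 1) * (2 - 2) / 2 * L ^ 2 + (2 - 1) = 1 := by norm_num
  rw [e] at h
  exact h

end Summit.Ventures.LatticeQCDFlow.Theory2.Autoregressive
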